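import Mathlib
import HarnessLib
import HarnessLib.Audit
import Summits.KontsevichZagierPeriods.Statement
import Summits.KontsevichZagierPeriods.KontsevichZagierPeriods.Theorems.TorsionLogsNeronTorsionSectorAssemblyMain
import HarnessLib.Audit.Status.Attr

/-!
Route: TorsionLogs

# Route TorsionLogs — torsion is a fixed point — Néron heights at torsion points and
Gross–Kohnen–Zagier CM values compile to logarithms

It suffices to show X = NeronTorsionSector ∧ TorsionSectorComplete (card
torsion-extensions-compile-to-logs-gkz; conforming re-open of the
retired sector route TorsionLogsGKZ). The route CLAIMS THE WHOLE SUMMIT as SECTOR + RELATIVE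
COMPLETENESS, both conjuncts being cruxes of
this route (rev 2–4): (i) NeronTorsionSector (rank 2, the mechanism) — every tied, integer-cleared
Néron–torsion identity among
the length-two iterated integral I(P), the quasi-period product η₁ω₁/2 and a logarithm is a chain of
KZ moves; (ii) TorsionSectorComplete
(crux, conjecture-grade, ranked last) — the KZ calculus enlarged by exactly those elements connects
any two rational representations of
equal value. (ii) has the strength of Conjecture 1 off a measure-zero family (the summit implies it:
`torsionSectorComplete_of_summit`, planner
Sketch.lean rc 0) and is claimed and staffed here at the lowest rank (an open-problem stamp is
expected, no kill); it coincides in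
substance with the kernel crux of Grothendieck / VeryGoodTransfer / CoactionDevissage /
ExpConservative (a completeness theorem
proved there implies it), this route's own lever on it being the mixed (height / biextension) layer.
MECHANISM: a MIXED period attached to a TORSION class is log-algebraic modulo pure
periods, and the certificate of torsion — a rational function, equivalently an isogeny fixing the
class — is exactly what rules 2)/3)
consume. Typed genus-1 layer: for a real curve y² = f(x) = 4x³ − g₂x − g₃ (largest root e₁ > 0, real
period ω₁ = 2∫_(e₁)^∞ dx/√f,
quasi-period η₁ = ∫_(e₁)^∞ (g₂x+2g₃)dx/(2x²√f)) and a real torsion point P of order N ≥ 3 on the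
identity component with
∫_(x_P)^∞ dx/√f = (a/N)ω₁, the LENGTH-TWO ITERATED integral I(P) = ∫∫_(e₁<x′<x<x_P)
x′dx′dx/(√f(x′)√f(x)) satisfies the Néron–torsion
identity I(P) + (ρ²/2)·η₁ω₁ = log α_P, ρ = 1/2 − a/N, α_P =
|ψ_(N−1)(x_P)|^(1/(N²−2N))·((e₁−e₂)(e₁−e₃))^(−1/4) real algebraic (value of the
archimedean Néron function at P; ψ_n the division polynomial). NeronTorsionSector (rev 2 = the tied
form C′ asked for by the crux-attack
refuter, who found rev 1 unprovable as quantified): every such identity, integer-cleared as M·I +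
k·(η₁ω₁/2) = m·log α with the TIE
4N²k = M(N−2a)² (k/M = ρ², the one ratio the Néron function produces) and with the value equality as
hypothesis, is a chain of KZ moves;
under the tie the value hypothesis is the multiplicative relation α^m = α_P^M between real algebraic
numbers, so no instance hides an open
transcendence question. The card's marquee family — Gross–Kohnen–Zagier CM values of higher Green
functions = archimedean heights of CM
cycles on Kuga–Sato threefolds (Zhang1997), KZ-representations by Zhou2015, algebraicity a theorem
(BruinierLiYang2025 Thm 1.4) — is the
same mechanism one dimension up and rides as the typed test crux GKZLevelOnePair and the support
GKZLevelThreePair.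
Lean: `Summit.KontsevichZagierPeriods.KontsevichZagierPeriods.Theses.TorsionLogs.NeronTorsionSector
∧ Summit.KontsevichZagierPeriods.KontsevichZagierPeriods.Theses.TorsionLogs.TorsionSectorComplete`

## Assembly
Deciding theorem `closes (h₁ : NeronTorsionSector) (h₂ : TorsionSectorComplete) :
KontsevichZagierPeriods` (certified: planner Sketch.lean
rc 0, axioms propext · Classical.choice · Quot.sound): from h₂, [r] − [r′] ∈ relations ⊔ closure(S)
for the set S of tied Néron–torsion
elements; h₁ says S ⊆ relations (S repeats the hypotheses of NeronTorsionSector verbatim, tie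
included), so `sup_le le_rfl (closure_le.mpr _)`
puts [r] − [r′] in relations, which is `KZ.Equivalent r r′`, i.e. the summit unfolded
(`KontsevichZagierPeriods_iff`). Both antecedents are
cruxes of this route; the ranked cruxes 3 and 4 and the supports are the unconditional deliverables
of the mechanism (two-layer plan) and
are not antecedents of `closes`. The `Assembly` item records the same implication as a Prop.

Rationale: WHY THIS LINE. Pure special-point identities come from Hodge classes (routes CyclesAsDomains,
MotivatedMoves, MultivaluedCoV); MIXED ones come from
torsion EXTENSION classes — heights and Abel–Jacobi integrals — and there the certificate is a
rational function / an isogeny fixed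
point: for the Néron function λ̃(u) = −log|σ(u)| + η₁u²/(2ω₁) (Lang1983 Ch. 13 Thm 1.1; Lang1987 Ch.
18 Thm 1–2; SilvermanATAEC1994
Ch. VI; MazurTate1991) one has λ̃(nu) = n²λ̃(u) − log|ψ_n(u)| and ω₁-periodicity, so (N−1)P = −P
forces λ̃(u_P) = log|ψ_(N−1)(P)|/(N²−2N),
while λ̃(u_P) − λ̃(ω₁/2) unfolds by ζ′ = −℘ into the honest 2-dimensional algebraic representation
I(P) plus (ρ²/2)η₁ω₁ (derivation in the
gen-2 planner's NOTES.md; numerics to 1e-16 on three curves, two non-CM; refuter re-check 19/19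
cases incl. Δ < 0 to 8.9e-16, kit jobs
j003662/j004071). Imported areas: arithmetic of heights / biextensions (Neron1964,
GrossLocalHeights1986, MazurTate1991), Gross–Zagier–Zhang
heights of CM cycles and the GKZ conjecture (GrossZagier1986 §V, GrossKohnenZagier1987, Zhang1997,
BruinierLiYang2025, Zhou2015), real
semialgebraic move calculus for proofs. What no other route does: GenusOneIterated treats length-2
iterated integrals only between 2-TORSION
points (Kummer log by a reflection) and bets on associator/modular relations at length 3;
IsogenyCertificates/HermiteRigidity/LowDimension
transfer isogenies on 1-dimensional PURE periods; here an isogeny [n] acts on an ITERATED (mixed,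
length-2) representation with the cocycle
d(ψ_n′/ψ_n) and an N-torsion endpoint, producing the quadratic Néron term −(ρ²/2)η₁ω₁ — heights, not
associators — and the dimension-3 GKZ
pairs are the only KZ items in the tree whose numerical truth is a 2025 theorem with no
non-automorphic proof. Rev 2 (route-repair
2026-08-16, this planner): the complement of the sector is CLAIMED as the conjecture-grade crux
TorsionSectorComplete (the whole summit is
encompassed: sector + relative completeness, deciding theorem `closes` re-certified), and
NeronTorsionSector carries the tie 4N²k = M(N−2a)²
asked for by the crux-attack refuter (rev 1 was unprovable as quantified: its M = 0 slice k·η₁ω₁/2 =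
m·log α is open transcendence),
mirrored in TorsionSectorComplete's closure set. Negatives index (1 entry, kinematic convexity) is
unrelated.

RANKED CRUXES. #2 NeronTorsionSector (crux, rev 2 = tied form C′) — NÉRON–TORSION SECTOR (genus-1
layer of the card's general compiler). For all real g₂, g₃ with g₂³ ≠ 27g₃², f = 4x³−g₂x−g₃ with
largest root e₁ > 0, a point P = (x_P, y_P), x_P > e₁, of exact order N ≥ 3 in the Mathlib group law
of Y² = X³ − (g₂/4)X − g₃/4 (Y = y/2) with N·∫_(x_P)^∞ dx/√f = a·2∫_(e₁)^∞ dx/√f (0 < 2a < N), every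
α > 1 and integers M, k, m with 4N²k = M(N−2a)²: if rI = [e₁<x′<x<x_P, x′/(√f(x′)√f(x))], rP =
[x>e₁, x′>e₁, (1/√f(x))·(g₂x′+2g₃)/(2x′²√f(x′))] (value ω₁η₁/2) and rL = [1<t<α, 1/t] satisfy M·rI +
k·rP = m·rL in value, then M[rI] + k[rP] − m[rL] ∈ KZ.relations. Under the tie the value hypothesis
is α^m = α_P^M (α_P = |ψ_(N−1)(x_P)|^(1/(N²−2N))((e₁−e₂)(e₁−e₃))^(−1/4)); a prover builds ONE chain
for the primitive tied element by moves, gets the value identity free from soundness (relations ≤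
ker eval) and finishes with log-splitting moves (∫_1^(αβ) = ∫_1^α + ∫_α^(αβ), t ↦ t/α) — no analytic
Néron theory, no transcendence input. All algebraicity is forced by the existence of the
ℚ-semialgebraic reps. [difficulty: XL] (why it might fail: Known proofs of the value identity are
θ/σ-analytic or the product formula; a chain must push the n-sheeted map x ↦ x([n]Q) through a 2-dim
ITERATED domain with cocycle d(ψ_n′/ψ_n) and corners at e₁, x_P — if sheet transfer fails on
iterated domains the tied element is a theorem-backed counterexample to Conjecture 1.) [Lang1983,
Lang1987, SilvermanATAEC1994, MazurTate1991, Neron1964, GrossLocalHeights1986, KontsevichZagier2001]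
#3 NeronTorsionFlex (crux) — The first explicit non-CM instance (a tied instance: N = 3, a = 1,
(M,k,m) = (36,1,3), 4·9·1 = 36·1²): the curve y² = 4x³ − 28x + 24 (e = 2, 1, −3; j ∉ ℤ;
HodgeLevel/LowDimension's test curve) and its real flex P (order 3) on the identity component, x_P =
the root > 2 of ψ₃ = 3x⁴ − 42x² + 72x − 49 (x_P = 2.71626…, u_P = ω₁/3, ρ = 1/6): 36·[rI] + [rP] −
3·[rL] ∈ KZ.relations with rI = ∫∫_(2<x′<x<x_P) x′/(√f√f), rP = ∫∫_(x,x′>2)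
(28x′−48)/(2x′²√f(x′)√f(x)) (= η₁ω₁/2), rL = ∫_1^α dt/t, α = f(x_P)²/125 (36·I + η₁ω₁/2 = 6 log
f(x_P) − 9 log 5 = 5.5313986271573…, both sides). No value hypothesis: the identity is a theorem
(Néron function at a 3-torsion point: λ̃(u_P) = log|ψ₂(P)|/3 = log f(x_P)/6, λ̃(ω₁/2) =
log|ψ₃(e₁)|/8 = (log 25)/8). [deps: NeronTorsionSector] [difficulty: L] (why it might fail: The [2]-
or [5]-map certificate meets the 2-torsion corner x = 2 where ψ_2 vanishes (log-divergent corner,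
GenusOneIterated's 'regularisation trap'); an odd multiplier (5P = −P) avoids it but quintuples the
sheet count; no chain for a length-2 N-torsion identity exists on paper.) [Lang1983, Lang1987,
SilvermanATAEC1994, KontsevichZagier2001, WhittakerWatson1927]
#4 GKZLevelOnePair (crux) — The card's marquee family one dimension up (signature verbatim from the
retired route's stmt-4040): Mellit's case of Gross–Kohnen–Zagier (level 1, z′ = i, z = ρ), Zhou2015
Remark 9: G₂^(PSL₂ℤ)(ρ, i) = −(8π/3)∫₀¹ P_(−1/6)(ξ)² dξ = −(12/√3) log(2+√3); with Euler's integral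
for P_(−1/6) this is the 3-dim identity J₁ := ∫_((0,1)³) Π_(u∈{t,s})
u^(−1/6)(1−u)^(−5/6)(1−(1−ξ)u/2)^(−1/6) = 6√3·π·log(2+√3) = ∫ 1/w over {(u²+v²)² < 108, 1 < w <
2+√3}. CLAIM: KZ-equivalent. Here the torsion class is the CM Heegner cycle on the Kuga–Sato
threefold (height = G₂ by Zhang1997; torsion in CH² by Mellit's explicit rational equivalence), the
logarithm is log of a unit: the same mechanism as rank 2 with dim 3 chains (cut complex surfaces in
ℝ⁶). [deps: none formal] [difficulty: XL] (why it might fail: Only analytic/automorphic proofs exist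
(Legendre ODE + Gauss digamma; Borcherds/theta lifts, BruinierLiYang2025); compiling Mellit's
certificate needs Stokes on a cut complex surface with log poles whose fibre integrals are period
FUNCTIONS — may exceed the calculus.) [Zhou2015, BruinierLiYang2025, Zhang1997, GrossZagier1986,
GrossKohnenZagier1987]
#9 TorsionSectorComplete (crux, conjecture-grade; auto-crux rank 9 = lowest staffing priority;
CLAIMED, antecedent of `closes`) — COMPLETENESS OF THE KZ CALCULUS RELATIVE TO THE NÉRON–TORSION
SECTOR: the calculus ENLARGED by the tied Néron–torsion elements M[rI] + k[rP] − m[rL] (the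
instances of NeronTorsionSector rev 2, hypotheses repeated verbatim incl. the tie) as extra axioms
connects any two RATIONAL representations with equal value: [r] − [r′] ∈ relations ⊔ closure(tied
Néron–torsion elements). The complement of the sector inside Conjecture 1: with NeronTorsionSector
(closure ≤ relations) it IS the summit (`closes`), and the summit implies it
(`torsionSectorComplete_of_summit`), so it is refutable only by refuting KontsevichZagierPeriods;
Conjecture-1 strength off a measure-zero family, hence under the strength barriers
(kzConjecture_implies_oddZetaAlgIndep and companions); in substance the kernel crux of Grothendieck
/ VeryGoodTransfer / CoactionDevissage / ExpConservative, any of which discharges it; this route's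
contribution towards it is the mixed layer (general compiler, NOT DECOMPOSED YET). [difficulty:
open-problem] (why it might fail: It is Conjecture 1 off a measure-zero family: with the sector it
yields algebraic independence of ζ(3), ζ(5), … and of 2πi, log q (strength barriers, consequents
wide open), and the fixed rules calculus may be incomplete even where the abstract period conjecture
holds (HuberMullerStachPeriods2017 Rem. 13.1.8).) [KontsevichZagier2001,
HuberMullerStachPeriods2017, Ayoub2014, Fresan2024, HuberWustholz2022]
#9 TriangleConcatenation (support) — Chen concatenation of length-2 iterated integrals is domain
additivity: for a < b < c and a product integrand φ(x′)ψ(x) the ordered triangle over (a,c) splits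
into the triangles over (a,b), (b,c) and the rectangle (a,b)×(b,c): [r] − [r₁] − [r₂] − [r₃] ∈
KZ.relations (two domain-additivity moves plus null-set bookkeeping for the lines x = b, x′ = b via
KZ.of_mem_levelRel_of_volume_eq_zero). The bookkeeping every [n]-transfer of an iterated domain
needs (the image arc winds; full periods split off as rectangles = products); a complete candidate
proof is attached as refuter evidence (Proof13809.lean). [difficulty: provable-now]
[KontsevichZagier2001, arXiv:1301.3042]
#9 CertificateDlogUnfolds (support) — W-step calibration in dimension 1 (retired route's stmt-4042,
verbatim): on y² = x³+1 with the 6-torsion point P = (2,3), F = (y−2x+1)³(y−1)/x³ has norm (x−2)⁶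
and (x+1)dx/((x−2)y) = (1/6) d log(F/F̄); on the arc x ∈ (−1,0) ONE change of variables s = F/F̄
plus s = x⁻² gives ∫_(−1)^0 (x+1)dx/((2−x)√(x³+1)) = ∫_1^2 dx/(3x) = (log 2)/3 — the certificate's d
log is consumed by rule 2), never as a primitive. [difficulty: provable-now] [KontsevichZagier2001,
SilvermanATAEC1994]
#9 OneThirdPeriod (support) — Z-step calibration (retired route's stmt-4043, verbatim): on y² = x³+1
translation by the 3-torsion flex Q = (0,1) is the algebraic change of variables x ↦ −2x/(1+√(x³+1))
mapping (0,2) and (2,∞) bijectively onto (−1,0) and preserving dx/y; with two domain-additivity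
moves 3∫_(−1)^0 dx/√(x³+1) = ∫_(−1)^∞ dx/√(x³+1) — the torsion relation u_P = (a/N)ω₁ reached by
moves, the dimension-1 shadow of rank 2's hypothesis. [difficulty: provable-now]
[KontsevichZagier2001, Lang1987]
#9 GKZLevelThreePair (support; a typed TEST INSTANCE, not load-bearing) — Level-3 GKZ pair (retired
route's stmt-4041, verbatim): Zhou2015 Remark 9, G₂^(Γ₀(3))((3+i√3)/6, i/√3) = −2 log 2; J₃ :=
∫_((0,1)³) Π_(u∈{t,s}) u^(−1/3)(1−u)^(−2/3)(1−(1−ξ)u/2)^(−1/3) = 4√3·π·log 2 = ∫ 1/w over {(u²+v²)²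
< 48, 1 < w < 2}; KZ-equivalent. Support, not crux: no torsion certificate for the level-3 CM cycles
is in print (Beilinson–Bloch), so it tests the family, not the mechanism; value identity a theorem
(Zhou2015, BruinierLiYang2025). [difficulty: XL] [Zhou2015, BruinierLiYang2025, Zhang1997,
GrossKohnenZagier1987]

TWO-LAYER PLAN. Foreseen split of NeronTorsionSector (filed only when NeronTorsionFlex moves): by
the shuffle I(ηω) = ½[(∫_γ η)(∫_γ ω) − (I(ωη) − I(ηω))]
on the arc γ = (e₁, x_P): NeronTorsionSector ⇐ TorsionOmega (∫_γ dx/√f = ρ·ω₁ by moves: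
translation/[N]-transfer on a 1-dim pure
period, OneThirdPeriod is its N = 3 calibration) → TorsionEta (∫_γ x dx/√f = −ρ·η₁ − R(P)/N, R
rational in (x_P, y_P): the second-kind
torsion identity, [N−1]-transfer with the exact algebraic correction (1/n)d(ψ_n′/ψ_n)) →
TorsionAntisym (I(ωη) − I(ηω) on γ = c·ω₁ − 2 log α,
c algebraic: the genuinely 2-dimensional Kummer/area part; GenusOneIterated's KummerFamily is its
2-torsion case) with glue = shuffle
(Fubini + TriangleConcatenation) + the log-splitting step that turns the tied value hypothesis α^m =
α_P^M into moves. GKZLevelOnePair ⇐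
KugaSatoCertificateLevelOne (Mellit's rational equivalence written as explicit (C_i, f_i)) →
CompiledCertificate (typed instance of the
general compiler, NOT DECOMPOSED YET) → ZhangZhouBridge (Zhou's J₁-representation ≡ the biextension
representation; renormalisation handed to the
limit routes Deregularisation/StandardParts). TorsionSectorComplete is never split here: its
decompositions are the kernel routes.

KILL CRITERIA. Refutation of NeronTorsionSector (any tied instance), NeronTorsionFlex or
GKZLevelOnePair by an additive invariant FormalRep →+ A killing the
four move sets and separating the element refutes KontsevichZagierPeriods outright (each is implied
by the summit: the reps are
ℚ-semialgebraic hence algebraic data, exists_integralRep_sub + exists_isRational_equivalent; the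
values agree by theorems — Néron/σ-function
identity, checked to 1e-16; Zhou2015 Remark 9 + BruinierLiYang2025): close `refuted:<Decl>` and hand
the witness to route Neg.
TorsionSectorComplete cannot be refuted short of refuting the summit (it is implied by it); an
open-problem verdict on it is expected and is
NOT a kill. What retires THIS route without a refutation: every line on NeronTorsionFlex dead (sheet
transfer of the [5]×[5]-image of the
triangle cannot be reassembled by TriangleConcatenation + rectangles, and no other multiplier works)
⇒ close exhausted with the census; a
general theorem 'isogenies act by moves on iterated representations' proved in
IsogenyCertificates/MultivaluedCoV, or GenusOneIterated's
RationalKernel on the {ω,η} word sector, supersedes ranks 2–3 (keep rank 4) ⇒ close superseded.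
Refutation of a provable-now support ⇒ a
defect of the fixed calculus, report to operator.

NOT DECOMPOSED YET. The general compiler RATIONAL EQUIVALENCE ACTS BY MOVES (all dimensions) —
dropped as an item in rev 2 (stmt-14744 was informal and
untypable: it needs the shared definition 'ℚ-semialgebraic singular chains on X(ℂ) ⊂ ℝ^(2n) and
their KZ.IntegralRep', requested by
UnfoldedStokes/CyclesAsDomains) and kept HERE until that definition lands, then re-filed typed at
rank 5: for X smooth projective over
ℚ̄∩ℝ-data, a cycle Z = ∂Γ (Γ a ℚ-semialgebraic (2p+1)-chain on X(ℂ)) with an explicit rational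
equivalence N·Z = Σ_i div(f_i) (f_i rational
functions on subvarieties C_i of dimension p+1) and a form ω with logarithmic poles along a cycle W
disjoint from Z (Green/biextension form,
archimedean height ⟨Z,W⟩ = ∫_Γ ω): N·[∫_Γ ω] ≡ Σ_i Σ_(x ∈ C_i ∩ W) m_x·[log|f_i(x)| as ∫dt/t] +
[period of a CLOSED semialgebraic cycle] in
KZ.relations, by cutting C_i(ℂ) along f_i⁻¹(ray), Stokes with the form's own coefficients as
primitives, trace along f_i = sheet transfer
(rule 2 per branch + rule 1b), ray-log unfolding (risk: in codimension ≥ 2 the fibre integrals are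
period FUNCTIONS of t — the primitive
barrier — unless Stokes on the cut surface replaces them; sources GrossLocalHeights1986, Zhang1997,
BruinierLiYang2025 p. 5, Zhou2015 Remark 6,
Lang1983 Ch. 11). Genus-1 shadow = NeronTorsionSector; dimension-3 instances =
GKZLevelOnePair/GKZLevelThreePair. Also not filed:
KugaSatoCertificate at levels 2–4 (no rational equivalence in print; Beilinson–Bloch), the family
form of GKZ (needs higherGreenFunction/CM-point
definitions), the e₁ ≤ 0 variant of rank 2 (a shift x ↦ x − c with the η-form (−2cx² + (g₂/2−2c²)x +
g₂c/2 + g₃)dx/(2(x−c)²y)), points on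
the non-identity real component, and the p-adic shadow (MazurTate1991 σ_p) — all layer-2 children or
other routes.

CHEAPEST FALSIFIER. (1) DONE: the Néron–torsion identity I(P) + (ρ²/2)η₁ω₁ =
log|ψ_(N−1)(x_P)|/(N²−2N) − log|ψ₃(e₁)|/8 evaluated by tanh–sinh quadrature on
(g₂,g₃,N) = (4,0,4) [x_P = 1+√2: 0.350308493109875 both sides; η₁ω₁ = π], (4,1,3)
[0.1443063485452964] and (28,−24,3) [0.15364996186548;
36·I + η₁ω₁/2 = 3 log(f(x_P)²/125) = 5.5313986271573], cross-checked by two refuter seats (19/19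
cases incl. Δ < 0 to ≤ 8.9e-16; kit jobs
j003662, j004071). (2) For refuters: one explicit chain on paper for NeronTorsionFlex via the
[5]-map (5P = −P, odd multiplier avoids the
ψ₂-corner) — if the image of the triangle under [5]×[5] cannot be re-assembled from 25 sheets by
TriangleConcatenation and rectangles, rank 2
is in trouble before any Lean is written. (3) For the tie: the crux-attack refuter's
Evidence13805.lean shows the M = 0 slice of rev 1 is
exactly k·η₁ω₁/2 = m·log α (open); under rev 2 the slice is vacuous (4N²k = 0 ⇒ k = 0, planner
Sketch.lean).

NUMBERS. Flex instance (28,−24,N=3): e₁ = 2, x_P = 2.7162656079480385 (root of 3x⁴−42x²+72x−49), ω₁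
= 2.0189058199784227, η₁ = 1.2325555232344139,
I = 0.1190886629862511, ρ = 1/6, f(x_P) = 28.10806764…, α = f(x_P)²/125 = 6.3205077…; lemniscatic
(4,0,N=4): x_P = 1+√2, ω₁ = 2.62205755429,
η₁ω₁ = π, I = 0.2521337226851943, I + π/32 = (1/8)log(8+6√2) = 0.3503084931098754; (4,1,N=3): e₁ =
1.10715987, x_P = 1.65157127, I = 0.09912483923.
GKZ: J₁ = 6√3π log(2+√3) ≈ 42.997, J₃ = 4√3π log 2 ≈ 15.0868 (Zhou2015 Remark 9). Mazur: N ≤ 12 over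
ℚ, unbounded over ℚ̄∩ℝ.
Items (rev 2): 4 cruxes (NeronTorsionSector C′, NeronTorsionFlex, GKZLevelOnePair,
TorsionSectorComplete) + 4 supports + assembly = 9.

DEFINITION REQUESTS. (d1) `higherGreenFunctionCM` (Literature/NumberTheory/Automorphic):
G_k^(Γ₀(N))(z₁,z₂), CM points, with named facts Zhou2015 Thm 1.2.1 /
Remark 9 (KZ representations and the three evaluations), BruinierLiYang2025 Thm 1.4 (GKZ
algebraicity), Zhang1997 (height = Green
function value) — needed for the FAMILY form of rank 4, not for the typed items. (d2) semialgebraic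
singular chains on X(ℂ) ⊂ ℝ^(2n) and
their KZ representations (shared with UnfoldedStokes/CyclesAsDomains; gates the re-filing of the
general compiler). (d3) optional:
`neronFunctionReal` (the real-locus Néron function λ̃ with the facts periodicity and λ̃∘[n] = n²λ̃ −
log|ψ_n|, Lang1983 Ch. 11 §2 / Ch. 13
Thm 1.1) — would let rank 2 drop its value hypothesis altogether.

Novelty: Searches. Gen-2 planner (2026-08-15): `lit search --hybrid "local height sigma function division
polynomial archimedean Neron" --source local`
(12 book hits: Cornell–Silverman Arithmetic Geometry pp. 463–475 = GrossLocalHeights1986, Lang1983,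
Bombieri–Gubler, Masser1975 — none with
period/KZ content); `lit read book:lang1987-elliptic-functions` Ch. 18 pp. 182–184 READ (σ
quasi-periodicity Thm 1, ℘(z)−℘(a) via σ Thm 2);
`lit read book:lang1983-fundamentals-diophantine-geometry` Ch. 11 §1–2, Ch. 13 Thm 1.1 p. 258 READ
(Néron function, periodicity,
functoriality); crossref "archimedean local height torsion points division polynomial sigma function
explicit formula" (10 rows, none
relevant); `lit galaxy search` ×3 (biextension heights | KZ integrals for automorphic Green | local
height torsion σ ψ_n) --star all: 0 rows
(galaxy degraded); the summit's 85 route files grepped for Néron/addOrderOf/σ/torsion: only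
GenusOneIterated (2-torsion, length 2–3,
reflection + associators), IsogenyCertificates/HermiteRigidity (pure 1-dim isogeny transfer),
LowDimension 8773 / retired 4043 (torsion
translations in dim 1); GKZ side from gen-1 (Zhou2015 arXiv:1312.6352 READ, BruinierLiYang2025
arXiv:2204.10604 READ). Grounders g26-4 /
g26-24 (2026-08-15, tree q=4 + standard refs): VALUE identity classical (Lang1983 Ch. 13, Lang1987
Ch. 18, SilvermanATAEC1994 VI,
MazurTate1991, GrossLocalHeights1986), KZ-move membership NEW — no paper realises Néron-function
identities by Kontsevich–Zagier moves.
R  [refs: 1312.6352, 2204.10604, book:lang1987-elliptic-functions, book:lang1983-fundamentals-diophantine-geometry, GrossLocalHeights1986, Lang1983, Masser1975, Zhou2015, BruinierLiYang2025, Lang1987, SilvermanATAEC1994, MazurTate1991]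

Barriers (technique_class: rational-equivalence-transfer, isogeny-fixed-point): - technique_class: rational-equivalence-transfer, isogeny-fixed-point, mixed-regulator
- Literature.Barriers.KontsevichZagierPeriods.noSemialgebraicPrimitive_inv_sub_two: evaded in the
sector — logs enter only as [1<t<α, 1/t] and via exact algebraic corrections d(ψ_n′/ψ_n); the
iterated integral never gets a primitive (inner integral = extra variable); conceded one dimension
up (GKZ, rank 4: Stokes on the cut surface is the bet).
- Literature.Barriers.KontsevichZagierPeriods.kzConjecture_implies_oddZetaAlgIndep (+
_twoPiI_log_algIndep, _ellipticPeriods_algIndep): NOT evaded — the route claims the whole summit;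
the bite sits in the CLAIMED conjecture-grade crux TorsionSectorComplete (sector + it = summit;
summit ⇒ it, so any kernel route's completeness theorem implies it), ranked last; the sector cruxes
derive theorems (Néron/σ identity; Zhou2015, BruinierLiYang2025) or carry a tied value hypothesis =
a multiplicative relation of algebraic numbers.
- Literature.Barriers.KontsevichZagierPeriods.cressonViuSos_prop_3_2: not engaged — dissection +
sheetwise changes of variables, never one global map.
- Literature.Barriers.KontsevichZagierPeriods.not_complete_of_undecidable: met only via
TorsionSectorComplete; conditional on undecidability of Problem 1 in an effective coding (open;
computability half void by not_complete_of_undecidableNarrow) — does not bite today; the bet is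
Conjecture 1.
- Negatives index: 1 refuted statement (stmt-5394, KinematicFormulas) — unrelated.

History (route lifecycle, newest last):
- 2026-08-16T02:19:15Z · AUTO-CRUX: 1 conjecture-grade item(s) promoted to crux (TorsionSectorComplete) — refuter vetting / tiering apply (operator:999:1362873)
- 2026-08-16T03:07:16Z · rev 2: restated TorsionSectorComplete (stmt-KontsevichZagierPeriods-13808) — route-choice (a), partial-claim hold 2026-08-16T02:41Z: TorsionSectorComplete (stmt-13808), previously disowned in the texts, is now CLAIMED as ONE conjecture-g (planner-rchoice-KontsevichZagierPeriods-Torsio-9694d7e4-0)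
- 2026-08-16T03:08:12Z · rev 2: restated TorsionSectorComplete (stmt-KontsevichZagierPeriods-14194) — route-repair (badge; route.partial-claim) rev 2, step 1/2: the complement of the Néron–torsion sector is CLAIMED — TorsionSectorComplete stays kind=crux (conjec (planner-rbadge-KontsevichZagierPeriods-Torsion-938e7bbb-0)
- 2026-08-16T03:08:12Z · rev 2: dropped stmt-KontsevichZagierPeriods-14744 — route-repair (badge; route.partial-claim) rev 2, step 1/2: the complement of the Néron–torsion sector is CLAIMED — TorsionSectorComplete stays kind=crux (conjec (planner-rbadge-KontsevichZagierPeriods-Torsion-938e7bbb-0)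
- 2026-08-16T03:29:12Z · rev 3: restated NeronTorsionSector (stmt-KontsevichZagierPeriods-13805) — route-repair rev 3, step 2/2: NeronTorsionSector restated to the tied form C′ (extra hypothesis 4·N²·k = M·(N−2a)²) asked for by the crux-attack refuter (refute (planner-rbadge-KontsevichZagierPeriods-Torsion-938e7bbb-0)
- 2026-08-16T03:34:53Z · rev 4: dropped stmt-KontsevichZagierPeriods-13808, stmt-KontsevichZagierPeriods-14194 — route-choice (a) gen 2, hygiene only: option (a) is already carried out (rev 2/3: the complement of the Néron–torsion sector is the CLAIMED conjecture-grade cru (planner-rchoice-KontsevichZagierPeriods-Torsio-9694d7e4-g2-0)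
- 2026-08-26T13:39:24Z · DORMANT — reconciler: no traction for 6.8 d (last activity item-evidence-added at 2026-08-19T18:44:33Z); parked, not closed — `ledger route dormant route-KontsevichZagier (operator:999:3145561)
- 2026-08-31T11:38:49Z · REACTIVATED (open) — reconciler: reactivated — activity statement-checked at 2026-08-31T10:29:01Z after parking at 2026-08-26T13:39:24Z (operator:999:3273961)

sub-problem: KontsevichZagierPeriods · status: open · opened planner-plancard-KontsevichZagierPeriods-Kont-cea0fcd2-g2-0 2026-08-15T19:03:27Z · rev 10 · ledger route-KontsevichZagierPeriods-TorsionLogs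
GENERATED by the gate from the ledger (D-0016/17). Provers cite these decls: `theorem foo : Summit.KontsevichZagierPeriods.KontsevichZagierPeriods.Theses.TorsionLogs.<Decl> := …` in Summits/KontsevichZagierPeriods/KontsevichZagierPeriods/Theorems/<Name>.lean.
-/

namespace Summit.KontsevichZagierPeriods.KontsevichZagierPeriods.Theses.TorsionLogs

open scoped BigOperators Topology Manifold Classical MeasureTheory ProbabilityTheory Matrix InnerProductSpace ComplexConjugate ContinuousMap
open Filter Set Function TopologicalSpace MeasureTheory

attribute [summit_statement] _root_.KontsevichZagierPeriods

open Literature Periods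

-- earlier NeronTorsionSector (stmt-KontsevichZagierPeriods-13805, replaced 2026-08-16T03:29:12Z -> stmt-KontsevichZagierPeriods-14500): retired by None — ∀ (g₂ g₃ e₁ xP yP α : ℝ) (N a : ℕ) (M k m : ℤ) (f : ℝ → ℝ), (∀ x, f x = 4 * x ^ 3 - g₂ * x - g₃) → g₂ ^ 3 - 27 * g₃ ^ 2 ≠ 0 → f e₁ = 0 → 0 < e₁ → (∀ x, e₁ < x → 0 < f x) → e₁ < xP → yP ^ 2 = f xP → 3 ≤ N → 0 < a → 2 * a < N → (∀ hns : (⟨0, 0, 0, -g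
/-- item stmt-KontsevichZagierPeriods-14500 · crux · rank 2 · closed · proved by Summit.KontsevichZagierPeriods.KontsevichZagierPeriods.Cruxes.NeronTorsionSector.Translation.NeronTorsionSector_of @ fef74b2621b1 (prover) · by planner
why it might fail: Known proofs of the value identity are θ/σ-analytic or the product formula; a chain must push the n-sheeted map x ↦ x([n]Q) through a 2-dim ITERATED domain with cocycle d(ψ_n′/ψ_n) and corners at e₁, x_P — if sheet transfer fails there, the tied element is a theorem-backed counterexample.
sources: Lang1983, Lang1987, SilvermanATAEC1994, MazurTate1991, Neron1964, GrossLocalHeights1986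
[crux] NÉRON–TORSION SECTOR, rev 2 = tied form C′ (crux-attack refuter's repair of rev 1, which was
unprovable as quantified: its M = 0 slice k·η₁ω₁/2 = m·log α is open transcendence;
evidence-13805.md, Evidence13805.lean). For all real g₂, g₃ with g₂³ ≠ 27g₃², f = 4x³−g₂x−g₃ with
largest root e₁ > 0, a point P = (x_P, y_P), x_P > e₁, of exact order N ≥ 3 in the Mathlib group law
of Y² = X³ − (g₂/4)X − g₃/4 (Y = y/2) with N·∫_(x_P)^∞ dx/√f = a·2∫_(e₁)^∞ dx/√f (0 < 2a < N), every
α > 1 and integers M, k, m with the TIE 4N²k = M(N−2a)² (k/M = ρ², ρ = 1/2 − a/N, the one ratio the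
Néron function produces): if rI = [e₁<x′<x<x_P, x′/(√f(x′)√f(x))], rP = [x>e₁, x′>e₁,
(1/√f(x))·(g₂x′+2g₃)/(2x′²√f(x′))] (value ω₁η₁/2) and rL = [1<t<α, 1/t] satisfy M·rI + k·rP = m·rL
in value, then M[rI] + k[rP] − m[rL] ∈ KZ.relations. Under the tie the value hypothesis reads M·log
α_P = m·log α with α_P = |ψ_(N−1)(x_P)|^(1/(N²−2N))((e₁−e₂)(e₁−e₃))^(−1/4) (Néron–torsion identity
I(P) + (ρ²/2)η₁ω₁ = log α_P, a theorem), i.e. α^m = α_P^M between real algebraic numbers: a prover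
builds ONE chain for the primitive tied element q²[rI] + p²[rP] − [1<t<α_P^(q²), 1/t] (ρ = p/q) by
moves, reads the value identity of -/
@[route_item "route-KontsevichZagierPeriods-TorsionLogs", crux]
def NeronTorsionSector : Prop :=
  ∀ (g₂ g₃ e₁ xP yP α : ℝ) (N a : ℕ) (M k m : ℤ) (f : ℝ → ℝ), (∀ x, f x = 4 * x ^ 3 - g₂ * x - g₃) → g₂ ^ 3 - 27 * g₃ ^ 2 ≠ 0 → f e₁ = 0 → 0 < e₁ → (∀ x, e₁ < x → 0 < f x) → e₁ < xP → yP ^ 2 = f xP → 3 ≤ N → 0 < a → 2 * a < N → 4 * (N : ℤ) ^ 2 * k = M * ((N : ℤ) - 2 * (a : ℤ)) ^ 2 → (∀ hns : (⟨0, 0, 0, -g₂ / 4, -g₃ / 4⟩ : WeierstrassCurve ℝ).toAffine.Nonsingular xP (yP / 2), addOrderOf (WeierstrassCurve.Affine.Point.some xP (yP / 2) hns) = N) → (N : ℝ) * (∫ x in Set.Ioi xP, (Real.sqrt (f x))⁻¹) = a * (2 * ∫ x in Set.Ioi e₁, (Real.sqrt (f x))⁻¹) → 1 < α → ∀ (rI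 rP : Literature.NumberTheory.Transcendental.KZ.IntegralRep 2) (rL : Literature.NumberTheory.Transcendental.KZ.IntegralRep 1), rI.domain = {z | e₁ < z 1 ∧ z 1 < z 0 ∧ z 0 < xP} → Set.EqOn rI.integrand (fun z => z 1 / (Real.sqrt (f (z 1)) * Real.sqrt (f (z 0)))) rI.domain → rP.domain = {z | e₁ < z 0 ∧ e₁ < z 1} → Set.EqOn rP.integrand (fun z => (Real.sqrt (f (z 0)))⁻¹ * ((g₂ * z 1 + 2 * g₃) / (2 * (z 1) ^ 2 * Real.sqrt (f (z 1))))) rP.domain → rL.domain = {t | 1 < t 0 ∧ t 0 < α} → Set.EqOn rL.integrand (fun t => (t 0)⁻¹) rL.domain → (M : ℝ) * rI.value + k * rP.value = m * rL.value → M • Literature.NumberTheory.Transcendental.KZ.of rI + k • Literature.NumberTheory.Transcendental.KZ.of rP - m • Literature.NumberTheory.Transcendental.KZ.of rL ∈ Literature.NumberTheory.Transcendental.KZ.relations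

-- `NeronTorsionSector` holds: proved by `Summit.KontsevichZagierPeriods.KontsevichZagierPeriods.Cruxes.NeronTorsionSector.Translation.NeronTorsionSector_of` @ fef74b2621b1 (its module imports this route file, so no `_holds` link can be stated here).

-- earlier TorsionSectorComplete (stmt-KontsevichZagierPeriods-13808, replaced 2026-08-16T03:07:16Z -> stmt-KontsevichZagierPeriods-14194): retired by None — ∀ ⦃n m : ℕ⦄ (r : Literature.NumberTheory.Transcendental.KZ.IntegralRep n) (r' : Literature.NumberTheory.Transcendental.KZ.IntegralRep m), r.IsRational → r'.IsRational → r.value = r'.value → Literature.NumberTheory.Transcendental.KZ.of r - Litera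
-- earlier TorsionSectorComplete (stmt-KontsevichZagierPeriods-14194, replaced 2026-08-16T03:08:12Z -> stmt-KontsevichZagierPeriods-14212): retired by None — ∀ ⦃n m : ℕ⦄ (r : Literature.NumberTheory.Transcendental.KZ.IntegralRep n) (r' : Literature.NumberTheory.Transcendental.KZ.IntegralRep m), r.IsRational → r'.IsRational → r.value = r'.value → Literature.NumberTheory.Transcendental.KZ.of r - Litera
/-- item stmt-KontsevichZagierPeriods-14212 · crux · rank 9 · open · by planner
why it might fail: It is Conjecture 1 off a measure-zero family: with the sector it yields algebraic independence of ζ(3),ζ(5),… and of 2πi, log q (strength barriers, consequents wide open); and the fixed rules calculus may be incomplete even where the abstract period conjecture holds (HMS2017 Rem. 13.1.8).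
sources: KontsevichZagier2001, HuberMullerStachPeriods2017, Ayoub2014, Fresan2024, HuberWustholz2022
[crux · conjecture-grade · CLAIMED by this route, antecedent of `closes`, ranked last] COMPLETENESS
OF THE KZ CALCULUS RELATIVE TO THE NÉRON–TORSION SECTOR (rev 2: closure set = the tied instances of
NeronTorsionSector rev 2, hypotheses repeated verbatim incl. 4N²k = M(N−2a)²): the KZ calculus
ENLARGED by the tied Néron–torsion elements M[rI] + k[rP] − m[rL] as extra axioms connects any two
RATIONAL representations with equal value: [r] − [r′] ∈ relations ⊔ closure(tied Néron–torsion
elements). This is the complement of the sector inside Conjecture 1 and the route claims it: with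
NeronTorsionSector (closure ≤ relations) it IS the summit — the deciding theorem `closes` — and the
summit implies it (`torsionSectorComplete_of_summit`, planner Sketch.lean rc 0), so it is refutable
only by refuting KontsevichZagierPeriods. Strength = Conjecture 1 off a measure-zero family, hence
under the strength barriers kzConjecture_implies_oddZetaAlgIndep / _twoPiI_log_algIndep /
_ellipticPeriods_algIndep (HuberMullerStachPeriods2017 Prop. 13.2.6, Ayoub2014 Cor. 32, Fresan2024
§10.4); expected verdict open-problem; lowest staffing priority; in substance the kernel crux of
Grothendieck / VeryGoodTrans -/
@[route_item "route-KontsevichZagierPeriods-TorsionLogs", crux]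
def TorsionSectorComplete : Prop :=
  ∀ ⦃n m : ℕ⦄ (r : Literature.NumberTheory.Transcendental.KZ.IntegralRep n) (r' : Literature.NumberTheory.Transcendental.KZ.IntegralRep m), r.IsRational → r'.IsRational → r.value = r'.value → Literature.NumberTheory.Transcendental.KZ.of r - Literature.NumberTheory.Transcendental.KZ.of r' ∈ Literature.NumberTheory.Transcendental.KZ.relations ⊔ AddSubgroup.closure {d : Literature.NumberTheory.Transcendental.KZ.FormalRep | ∃ (g₂ g₃ e₁ xP yP α : ℝ) (N a : ℕ) (M k m : ℤ) (f : ℝ → ℝ) (rI rP : Literature.NumberTheory.Transcendental.KZ.IntegralRep 2) (rL : Literature.NumberTheory.Transcendental.KZ.IntegralRep 1), (∀ x, f x = 4 * x ^ 3 - g₂ * x - g₃) ∧ g₂ ^ 3 - 27 * g₃ ^ 2 ≠ 0 ∧ f e₁ = 0 ∧ 0 < e₁ ∧ (∀ x, e₁ < x → 0 < f x) ∧ e₁ < xP ∧ yP ^ 2 = f xP ∧ 3 ≤ N ∧ 0 < a ∧ 2 * a < N ∧ 4 * (N : ℤ) ^ 2 * k = M * ((N : ℤ) - 2 * (a : ℤ))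 ^ 2 ∧ (∀ hns : (⟨0, 0, 0, -g₂ / 4, -g₃ / 4⟩ : WeierstrassCurve ℝ).toAffine.Nonsingular xP (yP / 2), addOrderOf (WeierstrassCurve.Affine.Point.some xP (yP / 2) hns) = N) ∧ (N : ℝ) * (∫ x in Set.Ioi xP, (Real.sqrt (f x))⁻¹) = a * (2 * ∫ x in Set.Ioi e₁, (Real.sqrt (f x))⁻¹) ∧ 1 < α ∧ rI.domain = {z | e₁ < z 1 ∧ z 1 < z 0 ∧ z 0 < xP} ∧ Set.EqOn rI.integrand (fun z => z 1 / (Real.sqrt (f (z 1)) * Real.sqrt (f (z 0)))) rI.domain ∧ rP.domain = {z | e₁ < z 0 ∧ e₁ < z 1} ∧ Set.EqOn rP.integrand (fun z => (Real.sqrt (f (z 0)))⁻¹ * ((g₂ * z 1 + 2 * g₃) / (2 * (z 1) ^ 2 * Real.sqrt (f (z 1))))) rP.domain ∧ rL.domain = {t | 1 < t 0 ∧ t 0 < α} ∧ Set.EqOn rL.integrand (fun t => (t 0)⁻¹) rL.domain ∧ (M : ℝ) * rI.value + k * rP.value = m * rL.value ∧ d = M • Literature.NumberTheory.Transcendental.KZ.of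 rI + k • Literature.NumberTheory.Transcendental.KZ.of rP - m • Literature.NumberTheory.Transcendental.KZ.of rL}

/-- item stmt-KontsevichZagierPeriods-13806 · banked · rank 3 · closed · proved by Summit.KontsevichZagierPeriods.KontsevichZagierPeriods.TorsionLogs.NeronHeight.neronTorsionFlex @ 68cda4a19009 (prover) · by planner
why it might fail: The [2]- or [5]-map certificate meets the 2-torsion corner x = 2 where ψ_2 vanishes (log-divergent corner, GenusOneIterated's 'regularisation trap'); an odd multiplier (5P = −P) avoids it but quintuples the sheet count; no chain for a length-2 N-torsion identity exists on paper.
sources: Lang1983, Lang1987, SilvermanATAEC1994, KontsevichZagier2001, WhittakerWatson1927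
[crux] The first explicit non-CM instance: the curve y² = 4x³ − 28x + 24 (e = 2, 1, −3; j ∉ ℤ;
HodgeLevel/LowDimension's test curve) and its real flex P (order 3) on the identity component, x_P =
the root > 2 of ψ₃ = 3x⁴ − 42x² + 72x − 49 (x_P = 2.71626…, u_P = ω₁/3, ρ = 1/6): 36·[rI] + [rP] −
3·[rL] ∈ KZ.relations with rI = ∫∫_(2<x′<x<x_P) x′/(√f√f), rP = ∫∫_(x,x′>2)
(28x′−48)/(2x′²√f(x′)√f(x)) (= η₁ω₁/2), rL = ∫_1^α dt/t, α = f(x_P)²/125 (36·I + η₁ω₁/2 = 6 log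
f(x_P) − 9 log 5 = 5.5313986271573…, both sides, compute/results_purepy.txt). No value hypothesis:
the identity is a theorem (Néron function at a 3-torsion point: λ̃(u_P) = log|ψ₂(P)|/3 = log
f(x_P)/6, λ̃(ω₁/2) = log|ψ₃(e₁)|/8 = (log 25)/8). [deps: NeronTorsionSector] [difficulty: L] -/
@[route_item "route-KontsevichZagierPeriods-TorsionLogs"]
def NeronTorsionFlex : Prop :=
  ∀ (xP : ℝ), 2 < xP → 3 * xP ^ 4 - 42 * xP ^ 2 + 72 * xP - 49 = 0 → ∀ (rI rP : Literature.NumberTheory.Transcendental.KZ.IntegralRep 2) (rL : Literature.NumberTheory.Transcendental.KZ.IntegralRep 1), rI.domain = {z | 2 < z 1 ∧ z 1 < z 0 ∧ z 0 < xP} → Set.EqOn rI.integrand (fun z => z 1 / (Real.sqrt (4 * (z 1) ^ 3 - 28 * z 1 + 24) * Real.sqrt (4 * (z 0) ^ 3 - 28 * z 0 + 24))) rI.domain → rP.domain = {z | 2 < z 0 ∧ 2 < z 1} → Set.EqOn rP.integrand (fun z => (Real.sqrt (4 * (z 0) ^ 3 - 28 * z 0 + 24))⁻¹ * ((28 * z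 1 - 48) / (2 * (z 1) ^ 2 * Real.sqrt (4 * (z 1) ^ 3 - 28 * z 1 + 24)))) rP.domain → rL.domain = {t | 1 < t 0 ∧ t 0 < (4 * xP ^ 3 - 28 * xP + 24) ^ 2 / 125} → Set.EqOn rL.integrand (fun t => (t 0)⁻¹) rL.domain → (36 : ℤ) • Literature.NumberTheory.Transcendental.KZ.of rI + Literature.NumberTheory.Transcendental.KZ.of rP - (3 : ℤ) • Literature.NumberTheory.Transcendental.KZ.of rL ∈ Literature.NumberTheory.Transcendental.KZ.relations

-- `NeronTorsionFlex` holds: proved by `Summit.KontsevichZagierPeriods.KontsevichZagierPeriods.TorsionLogs.NeronHeight.neronTorsionFlex` @ 68cda4a19009 (its module imports this route file, so no `_holds` link can be stated here).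

/-- item stmt-KontsevichZagierPeriods-13807 · aside · rank 4 · open · by planner
why it might fail: Only analytic/automorphic proofs exist (Legendre ODE + Gauss digamma; Borcherds/theta lifts, BruinierLiYang2025); compiling Mellit's certificate needs Stokes on a cut complex surface with log poles whose fibre integrals are period FUNCTIONS — may exceed the calculus.
sources: Zhou2015, BruinierLiYang2025, Zhang1997, GrossZagier1986, GrossKohnenZagier1987
[crux] The card's marquee family one dimension up (signature verbatim from the retired route's
stmt-4040): Mellit's case of Gross–Kohnen–Zagier (level 1, z′ = i, z = ρ), Zhou2015 Remark 9:
G₂^(PSL₂ℤ)(ρ, i) = −(8π/3)∫₀¹ P_(−1/6)(ξ)² dξ = −(12/√3) log(2+√3); with Euler's integral for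
P_(−1/6) this is the 3-dim identity J₁ := ∫_((0,1)³) Π_(u∈{t,s})
u^(−1/6)(1−u)^(−5/6)(1−(1−ξ)u/2)^(−1/6) = 6√3·π·log(2+√3) = ∫ 1/w over {(u²+v²)² < 108, 1 < w <
2+√3}. CLAIM: KZ-equivalent. Here the torsion class is the CM Heegner cycle on the Kuga–Sato
threefold (height = G₂ by Zhang1997; torsion in CH² by Mellit's explicit rational equivalence), the
logarithm is log of a unit: the same mechanism as rank 2 with dim 3 chains (cut complex surfaces in
ℝ⁶). [deps: NeronTorsionSector] [difficulty: XL] -/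
@[route_item "route-KontsevichZagierPeriods-TorsionLogs"]
def GKZLevelOnePair : Prop :=
  ∀ (r r' : Literature.NumberTheory.Transcendental.KZ.IntegralRep 3), r.domain = {x | ∀ i, x i ∈ Set.Ioo (0:ℝ) 1} → Set.EqOn r.integrand (fun x => (x 0) ^ (-(1:ℝ) / 6) * (1 - x 0) ^ (-(5:ℝ) / 6) * (1 - (1 - x 2) * x 0 / 2) ^ (-(1:ℝ) / 6) * ((x 1) ^ (-(1:ℝ) / 6) * (1 - x 1) ^ (-(5:ℝ) / 6) * (1 - (1 - x 2) * x 1 / 2) ^ (-(1:ℝ) / 6))) r.domain → r'.domain = {x | (x 0 ^ 2 + x 1 ^ 2) ^ 2 < 108 ∧ x 2 ∈ Set.Ioo (1:ℝ) (2 + Real.sqrt 3)} → Set.EqOn r'.integrand (fun x => 1 / x 2) r'.domain → Literature.NumberTheory.Transcendental.KZ.Equivalent r r'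

/-- item stmt-KontsevichZagierPeriods-17981 · banked · rank 5 · closed · proved by Summit.KontsevichZagierPeriods.KontsevichZagierPeriods.Cruxes.NeronTorsionSector.Translation.stub_assembly @ 5497e8393cba (prover) · by planner
why it might fail: No value hypothesis: the chain must be BUILT with INTEGER coefficients. If the translation cocycle Q̃ is not ℚ-semialgebraic on every grid cell, or the elimination leaves an odd coefficient, only d•(…) ∈ relations comes out — and saturation on this sector is conjecture-strength.
sources: Lang1983, SilvermanATAEC1994, KontsevichZagier2001, Lawden1989
[crux] PRIMITIVE NÉRON–TORSION CHAIN (X₁ of the BC2 redirect of NeronTorsionSector; = the lead's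
stub_assembly verbatim, the crux's transfer C⁺). For the curve/torsion data of NeronTorsionSector
(real cubic f = 4x³ − g₂x − g₃, g₂³ ≠ 27g₃², largest root e₁ > 0, P = (x_P, y_P) of exact order N ≥
3 on the identity component with N·∫_(x_P)^∞ dx/√f = a·ω₁, 0 < 2a < N) and ρ = 1/2 − a/N = p/q in
lowest terms (p ⊥ q, q(N−2a) = 2Np): there are c ∈ ℤ, a real algebraic B > 1 and a log carrier rB =
[1<t<B, dt/t] with q²•[rI] + p²•[rP] − c•[rB] ∈ KZ.relations (rI = [e₁<x′<x<x_P, x′/(√f√f′)], rP =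
[(e₁,∞)², (1/√f(x))(g₂x′+2g₃)/(2x′²√f(x′))], value η₁ω₁/2). NO value hypothesis: ONE chain, to be
BUILT; by soundness it contains the classical Néron–torsion identity q²I + p²η₁ω₁/2 = c log B (Lang
1983 Ch. 13 Thm 1.1) and, with IntervalLogRelations, it gives the whole tied family (glue
NeronTorsionSector_of_subs, complete proof attached as evidence). Plans: the lead's live line
Lines/birth.lean v2 (translation-only chain: regular second-kind density h = (g₂x+2g₃)/(4x²), grid
x_k = X(kω/n), cocycle h∘τ − h = dQ̃, dlog unfolding, integer elimination; blocks
realDictionary/parametersAlgebraic landed) an -/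
@[route_item "route-KontsevichZagierPeriods-TorsionLogs"]
def NeronTorsionPrimitiveChain : Prop :=
  ∀ (g₂ g₃ e₁ xP yP : ℝ) (N a p q : ℕ) (f : ℝ → ℝ), (∀ x, f x = 4 * x ^ 3 - g₂ * x - g₃) → g₂ ^ 3 - 27 * g₃ ^ 2 ≠ 0 → f e₁ = 0 → 0 < e₁ → (∀ x, e₁ < x → 0 < f x) → e₁ < xP → yP ^ 2 = f xP → 3 ≤ N → 0 < a → 2 * a < N → (∀ hns : (⟨0, 0, 0, -g₂ / 4, -g₃ / 4⟩ : WeierstrassCurve ℝ).toAffine.Nonsingular xP (yP / 2), addOrderOf (WeierstrassCurve.Affine.Point.some xP (yP / 2) hns) = N) → (N : ℝ) * (∫ x in Set.Ioi xP, (Real.sqrt (f x))⁻¹) = a * (2 * ∫ x in Set.Ioi e₁, (Real.sqrt (f x))⁻¹) → Nat.Coprime p q → (q : ℤ) * ((N : ℤ) - 2 * (a : ℤ)) = (p : ℤ) * (2 * (N : ℤ)) → ∀ (rI rP : Literature.NumberTheory.Transcendental.KZ.IntegralRep 2), rI.domain = {z | e₁ < z 1 ∧ z 1 < z 0 ∧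 z 0 < xP} → Set.EqOn rI.integrand (fun z => z 1 / (Real.sqrt (f (z 1)) * Real.sqrt (f (z 0)))) rI.domain → rP.domain = {z | e₁ < z 0 ∧ e₁ < z 1} → Set.EqOn rP.integrand (fun z => (Real.sqrt (f (z 0)))⁻¹ * ((g₂ * z 1 + 2 * g₃) / (2 * (z 1) ^ 2 * Real.sqrt (f (z 1))))) rP.domain → ∃ (c : ℤ) (B : ℝ) (rB : Literature.NumberTheory.Transcendental.KZ.IntegralRep 1), 1 < B ∧ IsAlgebraic ℚ B ∧ rB.domain = {t | 1 < t 0 ∧ t 0 < B} ∧ Set.EqOn rB.integrand (fun t => (t 0)⁻¹) rB.domain ∧ ((q : ℤ) ^ 2) • Literature.NumberTheory.Transcendental.KZ.of rI + ((p : ℤ) ^ 2) • Literature.NumberTheory.Transcendental.KZ.of rP - c • Literature.NumberTheory.Transcendental.KZ.of rB ∈ Literature.NumberTheory.Transcendental.KZ.relations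

/-- `NeronTorsionPrimitiveChain` holds: proved by `Summit.KontsevichZagierPeriods.KontsevichZagierPeriods.Cruxes.NeronTorsionSector.Translation.stub_assembly` @ 5497e8393cba. -/
theorem NeronTorsionPrimitiveChain_holds : NeronTorsionPrimitiveChain := _root_.Summit.KontsevichZagierPeriods.KontsevichZagierPeriods.Cruxes.NeronTorsionSector.Translation.stub_assembly

/-- item stmt-KontsevichZagierPeriods-18116 · aside · rank 6 · open · by planner
why it might fail: Period-conjecture strength in kind (Fait 1.4; GPC-type consequences); false iff ONE algebraic power series of polyradius > 1 with ∫ = 0 lies outside the ℚ-span of Stokes elements in every number of extra variables (Rem 1.2: with the variable count fixed it IS false).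
sources: Ayoub2015, Fresan2024, Ayoub2014, AyoubRelKZRevisited, HuberWustholz2022
[crux] AYOUB'S EFFECTIVE CUBE CONJECTURE at k = ℚ (piece X₂ of the BC2-redirect split of
ReductionRigidity, crux-strategist r1; PRINTED: J. Ayoub, Ann. of Math. 181 (2015) Conj. 1.1 = J.
Fresán, X-UPS 2024 Conj. 3.5): the kernel of ∫_{[0,1]^∞} on 𝒪_{ℚ-alg}(𝔻̄^∞) — power series in
finitely many variables, polyradius of convergence > 1, algebraic over ℚ(z) (AyoubRel.Oan
(Rat.castHom ℂ), AyoubRel.intC) — is the ℚ-span (AyoubRel.kSpan) of the type-(a) elements ∂G/∂zᵢ −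
G|_{zᵢ=1} + G|_{zᵢ=0} (AyoubRel.relAC i G). Conjecture 1's TRANSCENDENCE content in Ayoub's LINEAR
presentation: one filtered function space, n commuting operators ∂ᵢ and the face restrictions, no
domains, no semialgebraic geometry, no rule (2); ⊇ is the tree theorem AyoubRel.intC_relAC_eq_zero;
the RELATIVE version is a THEOREM (AyoubRelKZRevisited Thm 1.11, tree fact
ayoub_integration_injective_localized: injective after inverting 2πi); the variable count cannot be
bounded (Ayoub Rem 1.2; tree: kernelElt_not_stokes_one_variable). Verbatim the registered stub
stub_ayoubEffectiveCubeKernel S6 of crux stmt-10813; ⇔ the summit-side @[conjecture] leaf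
TypeAGenerationConjecture (AyoubRel.typeAGeneration_forall_iff_rat, algeb -/
@[route_item "route-KontsevichZagierPeriods-TorsionLogs", crux]
def AyoubEffectiveCubeKernel : Prop :=
  ∀ F ∈ Literature.NumberTheory.Transcendental.AyoubRel.Oan (Rat.castHom ℂ), Literature.NumberTheory.Transcendental.AyoubRel.intC F = 0 → F ∈ Literature.NumberTheory.Transcendental.AyoubRel.kSpan (Rat.castHom ℂ) {x : Literature.NumberTheory.Transcendental.AyoubRel.CSeries | ∃ G ∈ Literature.NumberTheory.Transcendental.AyoubRel.Oan (Rat.castHom ℂ), ∃ i : ℕ, x = Literature.NumberTheory.Transcendental.AyoubRel.relAC i G}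

/-- item stmt-KontsevichZagierPeriods-17978 · support · rank 7 · open · by planner
why it might fail: In substance it no longer can: certified provable from the landed cubeNashNormalForm_proof + cubeResolution_of_cubeNashNormalForm (evidence CubeResolutionNow.lean: cubeResolution_item, rc0, axioms standard); open on the ledger only until a prover lands the by-name file.
sources: KontsevichZagier2001, Ayoub2014, HuberMullerStachPeriods2017, Hironaka1964, BierstoneMilman1988, Parusinski1994
[crux] CUBE RESOLUTION — GEOMETRY INSIDE THE RULES (piece X₁ of the BC2-redirect split of the rank-0
target ReductionRigidity, crux-strategist re-audit r1, 2026-08-17): every integral representation of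
the H21 calculus is congruent modulo KZ.relations to a ℤ-combination of TAME CUBE classes [[0,1]ⁿ,
f], f real analytic on a neighbourhood of the closed cube — Ayoub's compact presentation (Ayoub2014
Def 9–10, Prop 11; HMS 2017 Thm 12.2.1 at the level of VALUES) realised by MOVES: compactification,
cell decomposition and Nash charts of cells (rules 1a, 2), then embedded resolution /
rectilinearisation of the boundary singularities of the Nash integrands by blow-up charts and power
substitutions t = τᴺ as rule-(2) instances on open pieces, absolute integrability forcing the
exponents ≥ 0 after τᴺ. Transcendence-free, Hironaka strength, XL. Byte-identical up to unfolding
(cube = {x | ∀ i, 0 ≤ x i ∧ x i ≤ 1} = KZ.cube = ReducedPeriodRing.unitCube, span =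
ReducedPeriodRing.cubicalSpan) with the registered stubs stub_cubeResolution S1 of crux stmt-10813
(FurushoPentagon.SectorToKernel) and S1b of crux stmt-3929 (ReducedPeriodRing) — ONE statement
staffed hub-wide; implied verbatim by item -/
@[route_item "route-KontsevichZagierPeriods-TorsionLogs", crux]
def CubeResolution : Prop :=
  ∀ (N : ℕ) (u : Literature.NumberTheory.Transcendental.KZ.IntegralRep N), ∃ c ∈ AddSubgroup.closure {d : Literature.NumberTheory.Transcendental.KZ.FormalRep | ∃ (n : ℕ) (r : Literature.NumberTheory.Transcendental.KZ.IntegralRep n), r.domain = {x : Fin n → ℝ | ∀ i, 0 ≤ x i ∧ x i ≤ 1} ∧ AnalyticOnNhd ℝ r.integrand {x : Fin n → ℝ | ∀ i, 0 ≤ x i ∧ x i ≤ 1} ∧ d = Literature.NumberTheory.Transcendental.KZ.of r}, Literature.NumberTheory.Transcendental.KZ.of u - c ∈ Literature.NumberTheory.Transcendental.KZ.relations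

/-- item stmt-KontsevichZagierPeriods-13809 · support · rank 9 · closed · proved by Summit.KontsevichZagierPeriods.KontsevichZagierPeriods.Theorems.triangleConcatenation_proof @ fcb42a1cae1d (prover) · by planner
sources: KontsevichZagier2001, arXiv:1301.3042
[support] Chen concatenation of length-2 iterated integrals is domain additivity: for a < b < c and
a product integrand φ(x′)ψ(x) the ordered triangle over (a,c) splits into the triangles over (a,b),
(b,c) and the rectangle (a,b)×(b,c): [r] − [r₁] − [r₂] − [r₃] ∈ KZ.relations (two domain-additivity
moves plus null-set bookkeeping for the lines x = b, x′ = b via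
KZ.of_mem_levelRel_of_volume_eq_zero). The bookkeeping every [n]-transfer of an iterated domain
needs (the image arc winds; full periods split off as rectangles = products). [difficulty:
provable-now] -/
@[route_item "route-KontsevichZagierPeriods-TorsionLogs"]
def TriangleConcatenation : Prop :=
  ∀ (a b c : ℝ) (φ ψ : ℝ → ℝ), a < b → b < c → ∀ (r r₁ r₂ r₃ : Literature.NumberTheory.Transcendental.KZ.IntegralRep 2), r.domain = {z | a < z 1 ∧ z 1 < z 0 ∧ z 0 < c} → r₁.domain = {z | a < z 1 ∧ z 1 < z 0 ∧ z 0 < b} → r₂.domain = {z | b < z 1 ∧ z 1 < z 0 ∧ z 0 < c} → r₃.domain = {z | a < z 1 ∧ z 1 < b ∧ b < z 0 ∧ z 0 < c} → Set.EqOn r.integrand (fun z => φ (z 1) * ψ (z 0)) r.domain → Set.EqOn r₁.integrand (fun z => φ (z 1) * ψ (z 0)) r₁.domain → Set.EqOn r₂.integrand (fun z => φ (z 1) * ψ (z 0)) r₂.domain → Set.EqOn r₃.integrand (fun z => φ (z 1) * ψ (z 0)) r₃.domain → Literature.NumberTheory.Transcendental.KZ.of r - Literature.NumberTheory.Transcendental.KZ.of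 r₁ - Literature.NumberTheory.Transcendental.KZ.of r₂ - Literature.NumberTheory.Transcendental.KZ.of r₃ ∈ Literature.NumberTheory.Transcendental.KZ.relations

-- `TriangleConcatenation` holds: proved by `Summit.KontsevichZagierPeriods.KontsevichZagierPeriods.Theorems.triangleConcatenation_proof` @ fcb42a1cae1d (its module imports this route file, so no `_holds` link can be stated here).

/-- item stmt-KontsevichZagierPeriods-13810 · support · rank 9 · closed · proved by Summit.KontsevichZagierPeriods.TorsionLogs.CertificateDlogUnfolds.CertificateDlogUnfolds_proof @ a3022ab2aaa0 (prover) · by planner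
sources: KontsevichZagier2001, SilvermanATAEC1994
[support] W-step calibration in dimension 1 (retired route's stmt-4042, verbatim): on y² = x³+1 with
the 6-torsion point P = (2,3), F = (y−2x+1)³(y−1)/x³ has norm (x−2)⁶ and (x+1)dx/((x−2)y) = (1/6) d
log(F/F̄); on the arc x ∈ (−1,0) ONE change of variables s = F/F̄ plus s = x⁻² gives ∫_(−1)^0
(x+1)dx/((2−x)√(x³+1)) = ∫_1^2 dx/(3x) = (log 2)/3 — the certificate's d log is consumed by rule 2),
never as a primitive. [difficulty: provable-now] -/
@[route_item "route-KontsevichZagierPeriods-TorsionLogs"]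
def CertificateDlogUnfolds : Prop :=
  ∀ (r r' : Literature.NumberTheory.Transcendental.KZ.IntegralRep 1), r.domain = {x | x 0 ∈ Set.Ioo (-1:ℝ) 0} → Set.EqOn r.integrand (fun x => (x 0 + 1) / ((2 - x 0) * Real.sqrt (x 0 ^ 3 + 1))) r.domain → r'.domain = {x | x 0 ∈ Set.Ioo (1:ℝ) 2} → Set.EqOn r'.integrand (fun x => 1 / (3 * x 0)) r'.domain → Literature.NumberTheory.Transcendental.KZ.Equivalent r r'

-- `CertificateDlogUnfolds` holds: proved by `Summit.KontsevichZagierPeriods.TorsionLogs.CertificateDlogUnfolds.CertificateDlogUnfolds_proof` @ a3022ab2aaa0 (its module imports this route file, so no `_holds` link can be stated here).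

/-- item stmt-KontsevichZagierPeriods-13811 · support · rank 9 · closed · proved by Summit.KontsevichZagierPeriods.TorsionLogs.OneThirdPeriod.OneThirdPeriod_proof (prover) · by planner
sources: KontsevichZagier2001, Lang1987
[support] Z-step calibration (retired route's stmt-4043, verbatim): on y² = x³+1 translation by the
3-torsion flex Q = (0,1) is the algebraic change of variables x ↦ −2x/(1+√(x³+1)) mapping (0,2) and
(2,∞) bijectively onto (−1,0) and preserving dx/y; with two domain-additivity moves 3∫_(−1)^0
dx/√(x³+1) = ∫_(−1)^∞ dx/√(x³+1) — the torsion relation u_P = (a/N)ω₁ reached by moves, the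
dimension-1 shadow of rank 2's hypothesis. [difficulty: provable-now] -/
@[route_item "route-KontsevichZagierPeriods-TorsionLogs"]
def OneThirdPeriod : Prop :=
  ∀ (r r' : Literature.NumberTheory.Transcendental.KZ.IntegralRep 1), r.domain = {x | x 0 ∈ Set.Ioo (-1:ℝ) 0} → Set.EqOn r.integrand (fun x => 3 / Real.sqrt (x 0 ^ 3 + 1)) r.domain → r'.domain = {x | -1 < x 0} → Set.EqOn r'.integrand (fun x => 1 / Real.sqrt (x 0 ^ 3 + 1)) r'.domain → Literature.NumberTheory.Transcendental.KZ.Equivalent r r'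

-- `OneThirdPeriod` holds: proved by `Summit.KontsevichZagierPeriods.TorsionLogs.OneThirdPeriod.OneThirdPeriod_proof` (its module imports this route file, so no `_holds` link can be stated here).

/-- item stmt-KontsevichZagierPeriods-13812 · support · rank 9 · open · by planner
sources: Zhou2015, BruinierLiYang2025, Zhang1997, GrossKohnenZagier1987
[support] Level-3 GKZ pair (retired route's stmt-4041, verbatim): Zhou2015 Remark 9,
G₂^(Γ₀(3))((3+i√3)/6, i/√3) = −2 log 2; J₃ := ∫_((0,1)³) Π_(u∈{t,s})
u^(−1/3)(1−u)^(−2/3)(1−(1−ξ)u/2)^(−1/3) = 4√3·π·log 2 = ∫ 1/w over {(u²+v²)² < 48, 1 < w < 2};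
KZ-equivalent. Support, not crux: no torsion certificate for the level-3 CM cycles is in print
(Beilinson–Bloch), so it tests the family, not the mechanism. [difficulty: XL] -/
@[route_item "route-KontsevichZagierPeriods-TorsionLogs"]
def GKZLevelThreePair : Prop :=
  ∀ (r r' : Literature.NumberTheory.Transcendental.KZ.IntegralRep 3), r.domain = {x | ∀ i, x i ∈ Set.Ioo (0:ℝ) 1} → Set.EqOn r.integrand (fun x => (x 0) ^ (-(1:ℝ) / 3) * (1 - x 0) ^ (-(2:ℝ) / 3) * (1 - (1 - x 2) * x 0 / 2) ^ (-(1:ℝ) / 3) * ((x 1) ^ (-(1:ℝ) / 3) * (1 - x 1) ^ (-(2:ℝ) / 3) * (1 - (1 - x 2) * x 1 / 2) ^ (-(1:ℝ) / 3))) r.domain → r'.domain = {x | (x 0 ^ 2 + x 1 ^ 2) ^ 2 < 48 ∧ x 2 ∈ Set.Ioo (1:ℝ) 2} → Set.EqOn r'.integrand (fun x => 1 / x 2) r'.domain → Literature.NumberTheory.Transcendental.KZ.Equivalent r r'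

/-- item stmt-KontsevichZagierPeriods-17982 · support · rank 9 · open · by planner
[support · provable-now: it IS the landed theorem
Summit.KontsevichZagierPeriods.HyperbolicBloch.OffTetraSectorKernel.interval_log_relation_mem_relations
(Theorems/HyperbolicBlochOffTetraSectorKernelRungZeroLogRelations.lean), close it by `exact` that]
INTERVAL-LOG RELATIONS (X₂ of the BC2 redirect of NeronTorsionSector): every ℤ-linear relation Σ mᵢ
log(βᵢ/αᵢ) = 0 among hyperbolic lengths of ℚ̄-intervals {αᵢ < t < βᵢ} (0 < αᵢ ≤ βᵢ real algebraic)
is a Kontsevich–Zagier relation Σ mᵢ•[{αᵢ<t<βᵢ}, dt/t] ∈ KZ.relations (Goncharov's rung 0: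
exponentiate to the exact multiplicative relation, dilations t ↦ ct are rule (2), cutting (1, qq′)
at q is rule (1a)). Load-bearing in the glue: it turns the value hypothesis of a tied instance,
(sc)·log B = m·log α, into moves. [difficulty: provable-now] [Goncharov1999, KontsevichZagier2001] -/
@[route_item "route-KontsevichZagierPeriods-TorsionLogs"]
def IntervalLogRelations : Prop :=
  ∀ (k : ℕ) (α β : Fin k → ℝ) (m : Fin k → ℤ) (r : Fin k → Literature.NumberTheory.Transcendental.KZ.IntegralRep 1), (∀ i, 0 < α i) → (∀ i, α i ≤ β i) → (∀ i, IsAlgebraic ℚ (α i)) → (∀ i, IsAlgebraic ℚ (β i)) → (∀ i, (r i).domain = {p : Fin 1 → ℝ | α i < p 0 ∧ p 0 < β i} ∧ Set.EqOn (r i).integrand (fun p : Fin 1 → ℝ => 1 / p 0) (r i).domain) → ∑ i, (m i : ℝ) * Real.log (β i / α i) = 0 → ∑ i, m i • Literature.NumberTheory.Transcendental.KZ.of (r i) ∈ Literature.NumberTheory.Transcendental.KZ.relations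

/-- item stmt-KontsevichZagierPeriods-17985 · support · rank 9 · open · by planner
sources: KontsevichZagier2001, Lang1983
[support · glue of the strategist split (BC2 redirect of NeronTorsionSector, cstrat-14500-r1);
PROVED, land verbatim] NeronTorsionPrimitiveChain → IntervalLogRelations → NeronTorsionSector. Proof
(theorem NeronTorsionSector_of_subs, evidence TorsionLogsNeronTorsionSectorSplit.lean on stmt-14500
and on this item; lean check rc0, axioms propext/Classical.choice/Quot.sound, ~100 tactic lines, NOT
a one-line seam): ρ = (N−2a)/(2N) = p/q in lowest terms (Nat.coprime_div_gcd_div_gcd); the tie 4N²k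
= M(N−2a)² gives q²k = p²M, so (M,k) = s(q²,p²) with s ∈ ℤ (IsCoprime.dvd_of_dvd_mul_left; no
division by integers is a rule); soundness KZ.relations_le_ker_eval_holds of the primitive chain +
the value hypothesis give (sc)·log B − m·log α = 0 (α algebraic: boundary point of the
ℚ-semialgebraic (1,α)); IntervalLogRelations realises it as (sc)•[rB] − m•[rL] ∈ relations;
M[rI]+k[rP]−m[rL] = s•(q²[rI]+p²[rP]−c[rB]) + ((sc)[rB]−m[rL]) (module). A PROVER lands the evidence
file as Theorems/TorsionLogsNeronTorsionSectorSplit.lean (--supports stmt-14500; planners are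
refused, perm.theorems-prover-only) and closes this item by `theorem … :
TorsionLogs.NeronTorsionSectorAssembly := fun h₁ h₂ => NeronTor -/
@[route_item "route-KontsevichZagierPeriods-TorsionLogs"]
def NeronTorsionSectorAssembly : Prop :=
  NeronTorsionPrimitiveChain → IntervalLogRelations → NeronTorsionSector

/-- item stmt-KontsevichZagierPeriods-13813 · assembly · rank 1 · closed · proved by Summit.KontsevichZagierPeriods.TorsionLogs.Assembly_proof @ b696d579b437 (prover) · by planner
sources: KontsevichZagier2001
[assembly] NeronTorsionSector → TorsionSectorComplete → the sub-problem statement. -/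
@[route_item "route-KontsevichZagierPeriods-TorsionLogs"]
def Assembly : Prop :=
  NeronTorsionSector → TorsionSectorComplete → KontsevichZagierPeriods

-- `Assembly` holds: proved by `Summit.KontsevichZagierPeriods.TorsionLogs.Assembly_proof` @ b696d579b437 (its module imports this route file, so no `_holds` link can be stated here).

/-! D-0027 §2.1 — DECIDING THEOREM (planner-authored via `route open/edit --closes-file`; by planner-rbadge-KontsevichZagierPeriods-Torsion-938e7bbb-0 2026-08-16T03:29:12Z):
its hypotheses are this route's items and its conclusion the sub-problem Statement (glue_lint), and it elaborates with this file. -/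

@[closes "route-KontsevichZagierPeriods-TorsionLogs"] theorem closes (h₁ : NeronTorsionSector) (h₂ : TorsionSectorComplete) : KontsevichZagierPeriods := by
  intro n m r r' hr hr' hv
  refine (sup_le le_rfl ((AddSubgroup.closure_le _).mpr ?_)) (h₂ r r' hr hr' hv)
  rintro d ⟨g₂, g₃, e₁, xP, yP, α, N, a, M, k, m', f, rI, rP, rL, hf, hdisc, he, he0, hpos, hx, hy, hN, ha,
    ha', htie, htor, hρ, hα, hdI, hiI, hdP, hiP, hdL, hiL, hval, rfl⟩
  exact h₁ g₂ g₃ e₁ xP yP α N a M k m' f hf hdisc he he0 hpos hx hy hN ha ha' htie htor hρ hα rI rP rL hdI hiI hdP hiP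
    hdL hiL hval

end Summit.KontsevichZagierPeriods.KontsevichZagierPeriods.Theses.TorsionLogs
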